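import Summits.CriticalPhenomena.PercolationContinuityZ3.Theorems.Transplant.SkelFrmQuasiBParamsFaceFloorsPiXA
import Summits.CriticalPhenomena.PercolationContinuityZ3.Theorems.Transplant.SkelFrmBParamsFaceFloorsPiXA
import Summits.CriticalPhenomena.PercolationContinuityZ3.Theorems.Transplant.SkelNegBParamsFaceFloorsZPiYA
import Summits.CriticalPhenomena.PercolationContinuityZ3.Theorems.Transplant.PlanarSkeletonFrmQuasiDefs
import Summits.CriticalPhenomena.PercolationContinuityZ3.Theorems.Transplant.PlanarSkeletonFrmDefs
import Summits.CriticalPhenomena.PercolationContinuityZ3.Theorems.Transplant.SkelPhiStepIDataNS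
import HarnessLib
import Summits.CriticalPhenomena.PercolationContinuityZ3.Theorems.Transplant.SkelFrmBParamsFaceFloorsZPiYA
/-!
# GEN-Q PORT (WAVE-Q table v0.8 section 2, row G202, U-level L20; captain R-6/R-7 2026-08-27: carrier token swap `PlanarSkeletonFrmFrom ↦ PlanarSkeletonFrmQuasi`)
# of the tree module «Transplant/SkelFrmFromBParamsFaceFloorsZPiYA» (sha256 614c7b63fa6cbd16…) onto the quasi-step carrier `PlanarSkeletonFrmQuasi` (p507026): «SkelFrmQuasiBParamsFaceFloorsZPiYA»

HAND HUNK (L-FLOORMAP-1 ①⑥ / L-KitS-1 reader side; G017 «SkelFrmQuasiBChoiceNums», hp-8's KitSN): R'0×7 — the (S0) kit of record at window cost `KS.NQ Φ`.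

ORIGINAL TITLE: (F) VALUE LAYER, N2 twin (hp-8 g42, 2026-08-23; F-DISCHARGE-MAP-N2 G18 y′-face REACH floors `hπ2Y`/`hπ3Y`): `port_frm.py` text of N1 `SkelNegBParamsFaceFloorsZPiYA`

builds on p205010 (kernel theorem, internal audit signed; external expert review pending) — nothing in this file uses p205010; NOTHING is claimed about any open node
((N3-b), the end state).  Lane `prim-bschramm`, seat `prim-bschramm-stmt` (gen 33; GEN-Q column pen; tool = captain gen-1 g4's port_genq.py R-14 --cone + p3-g30's T1 patch).  Helper file (`--supports stmt-CriticalPhenomena-4575 --as helper`).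
PORT RULES (U-wave r1–r4 re-used, GEN-Q hunk classes of p3-g29 #6136): declaration order, names and proof texts are those of «SkelFrmFromBParamsFaceFloorsZPiYA», byte-identical except
(i) the carrier token `PlanarSkeletonFrmFrom ↦ PlanarSkeletonFrmQuasi` in binders, `namespace`/`end` lines and qualified names (module names `SkelFrmFrom… ↦ SkelFrmQuasi…`
in imports of already-ported rows); (ii) `Φ.step ↦ Φ.qstep` with the called Steps lemma replaced by its `…Q`/`_q` twin and the cost `Φ.M` threaded (none in this file unless
listed below); (iii) `Φ.cyl_connected ↦ Φ.cyl_reach` readers (none unless listed); (iv) graph-ball radii / window floors ×`Φ.M` (none unless listed).  Carrier-free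
residents stay imported/exported from the original «SkelFrmBParamsFaceFloorsZPiYA» exactly as in the FrmFrom port.  Docstrings and citations are the original's.

-/

noncomputable section

open scoped Classical

namespace Summit.CriticalPhenomena.PercolationContinuityZ3.Theorems.Transplant

namespace PlanarSkeletonFrmQuasi

namespace NegB

open Literature.Probability.Percolation Literature.Probability.LatticeModels SimpleGraph
open Literature.Probability.Percolation.KozmaNitzan.Cells (oth sgOf sgOf_sign)
open SkelConc (Consts)
open Skelφ (shearUnit shearUnit_pos crossOffY yPrmW)
open Skelφ.StepI (DataN)
open TwoAxis.Para (modulus)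
open Neg

namespace KS

/-! ## The y′-face reaches -/

section FloorsPiY

/-- **The tangential x-run's origin of a y′-face is within reach**: `|yT 0| + |yT 1| ≤ |yL 0| + |yL 1| + (Nr+1)·(11·n_L + ℓ_L) + 1` for
`yT = yL + crossOffY n_L ℓ_L h_L v_L σ Nr` (`σ = ±1`, `|v_L| ≤ n_L`, `|h_L| ≤ 10·n_L`, `ℓ_L ≥ 11`). [folklore] -/
theorem clr_crossOffY_l1 (κ : Consts) {V : Type} [DecidableEq V] [Countable V] {G : SimpleGraph V} [G.LocallyFinite] (Φ : PlanarSkeletonFrmQuasi G) (t : V) (p : unitInterval) (D : Skelφ.StepI.DataNS V) (mk : ℕ) (g : ℕ) (f : ℕ) (hN : EqNumL κ Φ t p D g f) (hκ : (hL κ Φ t p D g f).natAbs ≤ 10 * nL κ Φ t p D g f)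
    (hℓA : 22000 * Neg.Kq κ * (KS0.R'0N κ Φ (KS.NQ Φ) t p D mk + 2) ≤ ℓL κ Φ t p D g f) (yL : Site 2) {σ : ℤ} (hσ : σ = 1 ∨ σ = -1) (Nr : ℕ) :
    ((yL + crossOffY (nL κ Φ t p D g f) (ℓL κ Φ t p D g f) (hL κ Φ t p D g f) (vL κ Φ t p D g f) σ Nr) 0).natAbs +
        ((yL + crossOffY (nL κ Φ t p D g f) (ℓL κ Φ t p D g f) (hL κ Φ t p D g f) (vL κ Φ t p D g f) σ Nr) 1).natAbs ≤
      (yL 0).natAbs + (yL 1).natAbs + (Nr + 1) * (11 * nL κ Φ t p D g f + ℓL κ Φ t p D g f) + 1 := by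
  obtain ⟨hn1, -⟩ := one_le_of_eqNumL κ Φ t p D g f hN
  have hn0 : (0 : ℤ) < (nL κ Φ t p D g f : ℤ) := by exact_mod_cast hn1
  have hv := hN.v_le
  have hκ' : |hL κ Φ t p D g f| ≤ 10 * (nL κ Φ t p D g f : ℤ) := by rw [← Int.natCast_natAbs]; exact_mod_cast hκ
  have hU := shearUnit_pos hn1 (hL κ Φ t p D g f)
  obtain ⟨-, hU2⟩ := clr_shearUnit_bounds κ Φ t p D g f hκ
  have hσabs : |σ| = 1 := by rcases hσ with h | h <;> simp [h]
  have hq1 : 1 ≤ Neg.Kq κ := Neg.one_le_Kq κ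
  have hℓ11 : (11 : ℤ) ≤ (ℓL κ Φ t p D g f : ℤ) := by
    have h2 : 1 * (0 + 2) ≤ Neg.Kq κ * (KS0.R'0N κ Φ (KS.NQ Φ) t p D mk + 2) := Nat.mul_le_mul hq1 (by omega)
    have : 11 ≤ ℓL κ Φ t p D g f := by nlinarith only [hℓA, h2]
    exact_mod_cast this
  have hnℓ : (nL κ Φ t p D g f : ℤ) * 11 ≤ (nL κ Φ t p D g f : ℤ) * ℓL κ Φ t p D g f := mul_le_mul_of_nonneg_left hℓ11 hn0.le
  -- the along stride and its size
  set sLo : ℤ := ((nL κ Φ t p D g f : ℤ) * ℓL κ Φ t p D g f - (shearUnit (nL κ Φ t p D g f) (hL κ Φ t p D g f) : ℕ) + 1) /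
    (shearUnit (nL κ Φ t p D g f) (hL κ Φ t p D g f) : ℕ) with hsLo
  have sL' : (shearUnit (nL κ Φ t p D g f) (hL κ Φ t p D g f) : ℤ) * sLo ≤
      (nL κ Φ t p D g f : ℤ) * ℓL κ Φ t p D g f - (shearUnit (nL κ Φ t p D g f) (hL κ Φ t p D g f) : ℤ) + 1 := by rw [hsLo]; exact Int.mul_ediv_self_le hU.ne'
  have hs0 : 0 ≤ sLo := by rw [hsLo]; exact Int.ediv_nonneg (by linarith only [hU2, hnℓ]) hU.le
  have hk0 : (0 : ℤ) ≤ (Nr : ℤ) + 1 := by positivity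
  -- coordinates of the offset
  have e0 : (yL + crossOffY (nL κ Φ t p D g f) (ℓL κ Φ t p D g f) (hL κ Φ t p D g f) (vL κ Φ t p D g f) σ Nr) 0 =
      yL 0 + σ * (((Nr : ℤ) + 1) * vL κ Φ t p D g f) := by
    simp only [Pi.add_apply, Skelφ.crossOffY, Skelφ.pt_zero]
  set X : ℤ := σ * (((Nr : ℤ) + 1) * sLo) * (shearUnit (nL κ Φ t p D g f) (hL κ Φ t p D g f) : ℤ) + hL κ Φ t p D g f * (σ * (((Nr : ℤ) + 1) * vL κ Φ t p D g f)) with hX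
  have e1 : (yL + crossOffY (nL κ Φ t p D g f) (ℓL κ Φ t p D g f) (hL κ Φ t p D g f) (vL κ Φ t p D g f) σ Nr) 1 = yL 1 + X / (nL κ Φ t p D g f : ℤ) := by
    simp only [Pi.add_apply, Skelφ.crossOffY, Skelφ.pt_one, hX, hsLo]
  -- `|X| ≤ (Nr+1)·(nℓ + 10 n²)`, so `|X / n| ≤ (Nr+1)(ℓ + 10n) + 1`
  have hUs : (shearUnit (nL κ Φ t p D g f) (hL κ Φ t p D g f) : ℤ) * sLo ≤ (nL κ Φ t p D g f : ℤ) * ℓL κ Φ t p D g f := by linarith only [sL', hU]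
  have a1 : |σ * (((Nr : ℤ) + 1) * sLo) * (shearUnit (nL κ Φ t p D g f) (hL κ Φ t p D g f) : ℤ)| ≤ ((Nr : ℤ) + 1) * ((nL κ Φ t p D g f : ℤ) * ℓL κ Φ t p D g f) := by
    have e : σ * (((Nr : ℤ) + 1) * sLo) * (shearUnit (nL κ Φ t p D g f) (hL κ Φ t p D g f) : ℤ) = σ * (((Nr : ℤ) + 1) * ((shearUnit (nL κ Φ t p D g f) (hL κ Φ t p D g f) : ℤ) * sLo)) := by ring
    rw [e, abs_mul, hσabs, one_mul, abs_of_nonneg (mul_nonneg hk0 (mul_nonneg hU.le hs0))]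
    exact mul_le_mul_of_nonneg_left hUs hk0
  have a2 : |hL κ Φ t p D g f * (σ * (((Nr : ℤ) + 1) * vL κ Φ t p D g f))| ≤ 10 * (nL κ Φ t p D g f : ℤ) * (((Nr : ℤ) + 1) * (nL κ Φ t p D g f : ℤ)) := by
    rw [abs_mul, abs_mul, hσabs, one_mul, abs_mul, abs_of_nonneg hk0]
    exact mul_le_mul hκ' (mul_le_mul_of_nonneg_left hv hk0) (by positivity) (by positivity)
  have hXabs : |X| ≤ (nL κ Φ t p D g f : ℤ) * (((Nr : ℤ) + 1) * ((ℓL κ Φ t p D g f : ℤ) + 10 * (nL κ Φ t p D g f : ℤ))) := by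
    rw [hX]
    calc |σ * (((Nr : ℤ) + 1) * sLo) * (shearUnit (nL κ Φ t p D g f) (hL κ Φ t p D g f) : ℤ) + hL κ Φ t p D g f * (σ * (((Nr : ℤ) + 1) * vL κ Φ t p D g f))|
        ≤ |σ * (((Nr : ℤ) + 1) * sLo) * (shearUnit (nL κ Φ t p D g f) (hL κ Φ t p D g f) : ℤ)| + |hL κ Φ t p D g f * (σ * (((Nr : ℤ) + 1) * vL κ Φ t p D g f))| :=
          abs_add_le _ _
      _ ≤ ((Nr : ℤ) + 1) * ((nL κ Φ t p D g f : ℤ) * ℓL κ Φ t p D g f) + 10 * (nL κ Φ t p D g f : ℤ) * (((Nr : ℤ) + 1) * (nL κ Φ t p D g f : ℤ)) := add_le_add a1 a2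
      _ = (nL κ Φ t p D g f : ℤ) * (((Nr : ℤ) + 1) * ((ℓL κ Φ t p D g f : ℤ) + 10 * (nL κ Φ t p D g f : ℤ))) := by ring
  obtain ⟨x1, x2⟩ := abs_le.1 hXabs
  obtain ⟨f1, f2⟩ := PlanarSkeletonNeg.NegB.RootArith.floor_sandwich (x := X) hn0
  set qq := X / (nL κ Φ t p D g f : ℤ) with hqq
  set M : ℤ := ((Nr : ℤ) + 1) * ((ℓL κ Φ t p D g f : ℤ) + 10 * (nL κ Φ t p D g f : ℤ)) with hM
  have hq1' : qq ≤ M := by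
    by_contra hc; push Not at hc
    have : (nL κ Φ t p D g f : ℤ) * (M + 1) ≤ (nL κ Φ t p D g f : ℤ) * qq := mul_le_mul_of_nonneg_left (by linarith) hn0.le
    nlinarith
  have hq2' : -(M + 1) ≤ qq := by
    by_contra hc; push Not at hc
    have : (nL κ Φ t p D g f : ℤ) * qq ≤ (nL κ Φ t p D g f : ℤ) * (-(M + 1) - 1) := mul_le_mul_of_nonneg_left (by linarith) hn0.le
    nlinarith
  have hqabs : |qq| ≤ M + 1 := abs_le.2 ⟨by linarith, by linarith⟩
  have b0 : |σ * (((Nr : ℤ) + 1) * vL κ Φ t p D g f)| ≤ ((Nr : ℤ) + 1) * (nL κ Φ t p D g f : ℤ) := by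
    rw [abs_mul, hσabs, one_mul, abs_mul, abs_of_nonneg hk0]; exact mul_le_mul_of_nonneg_left hv hk0
  have key : (((yL + crossOffY (nL κ Φ t p D g f) (ℓL κ Φ t p D g f) (hL κ Φ t p D g f) (vL κ Φ t p D g f) σ Nr) 0).natAbs : ℤ) +
      (((yL + crossOffY (nL κ Φ t p D g f) (ℓL κ Φ t p D g f) (hL κ Φ t p D g f) (vL κ Φ t p D g f) σ Nr) 1).natAbs : ℤ) ≤
      ((yL 0).natAbs : ℤ) + ((yL 1).natAbs : ℤ) + ((Nr : ℤ) + 1) * (11 * (nL κ Φ t p D g f : ℤ) + ℓL κ Φ t p D g f) + 1 := by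
    simp only [Int.natCast_natAbs]
    rw [e0, e1]
    have t0 := abs_add_le (yL 0) (σ * (((Nr : ℤ) + 1) * vL κ Φ t p D g f))
    have t1 := abs_add_le (yL 1) qq
    have eM : M + ((Nr : ℤ) + 1) * (nL κ Φ t p D g f : ℤ) = ((Nr : ℤ) + 1) * (11 * (nL κ Φ t p D g f : ℤ) + ℓL κ Φ t p D g f) := by rw [hM]; ring
    linarith
  exact_mod_cast key

/-- **THE y′-FACE G-π REACH BUDGET** (N2: a NAMED number, cf. `πBudX` in FloorsPiXA-N2; N1 discharged it against the slot `exA` —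
`clr_floorπY_exA`, dropped; the one floor `πBudY c mk g f ≤ r` is served on `exQ` by the residual-slot file of record, stmt-g21 (S3)):
`YbF + 11·n_L + 1000·Kq·U + 11000·Kq·n_L + 1000·Kq·ℓ_L + 13`, plus one — WITH the y′ origins' extra `11·n_L` (N1's `…₂` variants of FloorsZPiYA2:
the y′ landing origins have `|yL|₁ ≤ YbF + n_L + |h_L| + 1 ≤ YbF + 11·n_L`). [folklore] -/
def πBudY (κ : Consts) {V : Type} [DecidableEq V] [Countable V] {G : SimpleGraph V} [G.LocallyFinite] (Φ : PlanarSkeletonFrmQuasi G) (t : V) (p : unitInterval) (D : Skelφ.StepI.DataNS V) (c : ℕ) (mk : ℕ) (g : ℕ) (f : ℕ) : ℕ :=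
  YbF κ Φ t p D c mk g f + 11 * nL κ Φ t p D g f + 1000 * Neg.Kq κ * shearUnit (nL κ Φ t p D g f) (hL κ Φ t p D g f) + 11000 * Neg.Kq κ * nL κ Φ t p D g f +
    1000 * Neg.Kq κ * ℓL κ Φ t p D g f + 13 + 1

/-- **M3 y′-face field `hπ2Y`, generic**: the along y′-run's origin plus every region's drift lies within the window radius `r`, from the ONE
r-floor `hr` (along count `Nr + 1 ≤ 1000·Kq`, origin `|yL|₁ ≤ YbF`). [cite: KozmaNitzan2024, §4 Lemma 12 (pp. 23–25)] -/
theorem hπ2Y_YA_gen (κ : Consts) {V : Type} [DecidableEq V] [Countable V] {G : SimpleGraph V} [G.LocallyFinite] (Φ : PlanarSkeletonFrmQuasi G) (t : V) (p : unitInterval) (D : Skelφ.StepI.DataNS V) (c : ℕ) (mk : ℕ) (g : ℕ) (f : ℕ) (hN : EqNumL κ Φ t p D g f) (hκ : (hL κ Φ t p D g f).natAbs ≤ 10 * nL κ Φ t p D g f)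
    (hℓA : 22000 * Neg.Kq κ * (KS0.R'0N κ Φ (KS.NQ Φ) t p D mk + 2) ≤ ℓL κ Φ t p D g f) (yL : Site 2) (hyl : (yL 0).natAbs + (yL 1).natAbs ≤ YbF κ Φ t p D c mk g f + 11 * nL κ Φ t p D g f)
    {Nr : ℕ} (hNr : Nr + 1 ≤ 1000 * Neg.Kq κ) (qB : ℕ) (r : ℕ) (hr : πBudY κ Φ t p D c mk g f ≤ r) :
    ∀ k ≤ Nr, ((yL 0).natAbs + (yL 1).natAbs) + (((((k + 1 : ℕ) : ℤ) * vL κ Φ t p D g f).natAbs +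
      (((shearUnit (nL κ Φ t p D g f) (hL κ Φ t p D g f) : ℤ) * |((k + 1 : ℕ) : ℤ) * (yPrmW (nL κ Φ t p D g f) (ℓL κ Φ t p D g f) (hL κ Φ t p D g f) (vL κ Φ t p D g f) (KS0.R'0N κ Φ (KS.NQ Φ) t p D mk) qB Nr).sLo| +
        |hL κ Φ t p D g f| * |((k + 1 : ℕ) : ℤ) * vL κ Φ t p D g f| + shearUnit (nL κ Φ t p D g f) (hL κ Φ t p D g f)) / nL κ Φ t p D g f).natAbs + 1)) ≤ r := by
  intro k hk
  obtain ⟨hn1, -⟩ := one_le_of_eqNumL κ Φ t p D g f hN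
  have hn0 : (0 : ℤ) < (nL κ Φ t p D g f : ℤ) := by exact_mod_cast hn1
  have hU := shearUnit_pos hn1 (hL κ Φ t p D g f)
  obtain ⟨-, hU2⟩ := clr_shearUnit_bounds κ Φ t p D g f hκ
  have hκ' : |hL κ Φ t p D g f| ≤ 10 * (nL κ Φ t p D g f : ℤ) := by rw [← Int.natCast_natAbs]; exact_mod_cast hκ
  have hq1 : 1 ≤ Neg.Kq κ := Neg.one_le_Kq κ
  have hℓ11 : (11 : ℤ) ≤ (ℓL κ Φ t p D g f : ℤ) := by
    have h2 : 1 * (0 + 2) ≤ Neg.Kq κ * (KS0.R'0N κ Φ (KS.NQ Φ) t p D mk + 2) := Nat.mul_le_mul hq1 (by omega)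
    have : 11 ≤ ℓL κ Φ t p D g f := by nlinarith only [hℓA, h2]
    exact_mod_cast this
  have hnℓ : (nL κ Φ t p D g f : ℤ) * 11 ≤ (nL κ Φ t p D g f : ℤ) * ℓL κ Φ t p D g f := mul_le_mul_of_nonneg_left hℓ11 hn0.le
  have hsLo : (yPrmW (nL κ Φ t p D g f) (ℓL κ Φ t p D g f) (hL κ Φ t p D g f) (vL κ Φ t p D g f) (KS0.R'0N κ Φ (KS.NQ Φ) t p D mk) qB Nr).sLo = sLoY κ Φ t p D g f := rfl
  rw [hsLo]
  have sL' : (shearUnit (nL κ Φ t p D g f) (hL κ Φ t p D g f) : ℤ) * sLoY κ Φ t p D g f ≤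
      (nL κ Φ t p D g f : ℤ) * ℓL κ Φ t p D g f - (shearUnit (nL κ Φ t p D g f) (hL κ Φ t p D g f) : ℤ) + 1 := by unfold sLoY; exact Int.mul_ediv_self_le hU.ne'
  have hs0 : 0 ≤ sLoY κ Φ t p D g f := by unfold sLoY; exact Int.ediv_nonneg (by linarith only [hU2, hnℓ]) hU.le
  have hk1 : ((k + 1 : ℕ) : ℤ) ≤ 1000 * (Neg.Kq κ : ℤ) := by
    have h3 : k + 1 ≤ 1000 * Neg.Kq κ := by omega
    exact_mod_cast h3
  have hterm := clr_kterm_le hn1 hN.v_le hκ' hU2 hs0 (by linarith only [sL', hU]) (by positivity : (0 : ℤ) ≤ (ℓL κ Φ t p D g f : ℤ))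
    (Nat.cast_nonneg _ : (0 : ℤ) ≤ ((k + 1 : ℕ) : ℤ)) hk1
  have hNn0 : 0 ≤ (shearUnit (nL κ Φ t p D g f) (hL κ Φ t p D g f) : ℤ) * |((k + 1 : ℕ) : ℤ) * sLoY κ Φ t p D g f| +
      |hL κ Φ t p D g f| * |((k + 1 : ℕ) : ℤ) * vL κ Φ t p D g f| + (shearUnit (nL κ Φ t p D g f) (hL κ Φ t p D g f) : ℤ) := by
    have a1 := mul_nonneg hU.le (abs_nonneg (((k + 1 : ℕ) : ℤ) * sLoY κ Φ t p D g f))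
    have a2 := mul_nonneg (abs_nonneg (hL κ Φ t p D g f)) (abs_nonneg (((k + 1 : ℕ) : ℤ) * vL κ Φ t p D g f))
    linarith only [a1, a2, hU]
  have hdiv0 := Int.ediv_nonneg hNn0 hn0.le
  refine le_trans ?_ hr
  unfold πBudY
  rw [← Nat.cast_le (α := ℤ)] at hyl ⊢
  push_cast at hdiv0 hterm
  push_cast [Int.natCast_natAbs] at hyl ⊢
  rw [abs_of_nonneg hdiv0]
  have hU0' : (0 : ℤ) ≤ 1000 * (Neg.Kq κ : ℤ) * (shearUnit (nL κ Φ t p D g f) (hL κ Φ t p D g f) : ℤ) := by positivity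
  linarith only [hyl, hterm, hU0']

/-- **M3 y′-face field `hπ3Y`, generic**: the tangential x-run's origin plus its `(N₃+1)` levels lies within the window radius `r`, from the ONE
r-floor `hr` (`Nr + 1 ≤ 1000·Kq`, `N₃ + 1 ≤ 1000·Kq`, `|yL|₁ ≤ YbF`). [cite: KozmaNitzan2024, §4 Lemma 12 (pp. 23–25)] -/
theorem hπ3Y_YA_gen (κ : Consts) {V : Type} [DecidableEq V] [Countable V] {G : SimpleGraph V} [G.LocallyFinite] (Φ : PlanarSkeletonFrmQuasi G) (t : V) (p : unitInterval) (D : Skelφ.StepI.DataNS V) (c : ℕ) (mk : ℕ) (g : ℕ) (f : ℕ) (hN : EqNumL κ Φ t p D g f) (hκ : (hL κ Φ t p D g f).natAbs ≤ 10 * nL κ Φ t p D g f)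
    (hℓA : 22000 * Neg.Kq κ * (KS0.R'0N κ Φ (KS.NQ Φ) t p D mk + 2) ≤ ℓL κ Φ t p D g f) (du : MDir) (yL : Site 2) (hyl : (yL 0).natAbs + (yL 1).natAbs ≤ YbF κ Φ t p D c mk g f + 11 * nL κ Φ t p D g f)
    {Nr N₃ : ℕ} (hNr : Nr + 1 ≤ 1000 * Neg.Kq κ) (hN₃ : N₃ + 1 ≤ 1000 * Neg.Kq κ) (r : ℕ) (hr : πBudY κ Φ t p D c mk g f ≤ r) :
    (((yL + crossOffY (nL κ Φ t p D g f) (ℓL κ Φ t p D g f) (hL κ Φ t p D g f) (vL κ Φ t p D g f) (sgOf du) Nr) 0).natAbs +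
        ((yL + crossOffY (nL κ Φ t p D g f) (ℓL κ Φ t p D g f) (hL κ Φ t p D g f) (vL κ Φ t p D g f) (sgOf du) Nr) 1).natAbs) +
      (N₃ + 1) * shearUnit (nL κ Φ t p D g f) (hL κ Φ t p D g f) ≤ r := by
  have hT := clr_crossOffY_l1 κ Φ t p D mk g f hN hκ hℓA yL (sgOf_sign du) Nr
  refine le_trans ?_ hr
  unfold πBudY
  have h1 : (Nr + 1) * (11 * nL κ Φ t p D g f + ℓL κ Φ t p D g f) ≤ 1000 * Neg.Kq κ * (11 * nL κ Φ t p D g f + ℓL κ Φ t p D g f) :=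
    Nat.mul_le_mul_right _ hNr
  have h2 : (N₃ + 1) * shearUnit (nL κ Φ t p D g f) (hL κ Φ t p D g f) ≤ 1000 * Neg.Kq κ * shearUnit (nL κ Φ t p D g f) (hL κ Φ t p D g f) :=
    Nat.mul_le_mul_right _ hN₃
  have e1 : 1000 * Neg.Kq κ * (11 * nL κ Φ t p D g f + ℓL κ Φ t p D g f) = 11000 * Neg.Kq κ * nL κ Φ t p D g f + 1000 * Neg.Kq κ * ℓL κ Φ t p D g f := by ring
  omega

end FloorsPiY

end KS

end NegB

end PlanarSkeletonFrmQuasi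

end Summit.CriticalPhenomena.PercolationContinuityZ3.Theorems.Transplant

end
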